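import Mathlib
import HarnessLib

/-!
# The Poincaré metric of the right half-plane in multiplicative form (Dubois 2009, (3.22))

Auxiliary real-variable estimates for the `δ`-diameter bound of
`Literature/Dynamics/Contraction/ComplexConeContraction.lean` (Dubois 2009, Thm 3.6, proved in
`ComplexConeContractionThm36Proofs.lean`). Dubois (3.22) uses the Poincaré metric of the right
half-plane `{Re > 0}`,
`ρ(a,b) = log ((|a + conj b| + |a − b|) / (|a + conj b| − |a − b|)) ≥ log (Re b / Re a)`,
its triangle inequality (the chain of discs in the proof of Thm 3.6), the Poincaré diameter
`log((Re c + r)/(Re c − r))` of a Euclidean disc `D̄(c,r) ⊂ {Re > 0}`, and the "straightforward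
identity" behind (3.24)–(3.25). We work with `exp ρ` in the squared form
`poincareExp a b = (|a + conj b| + |a − b|)² / (4 Re a Re b)` (equal to the printed quotient by
`|a + conj b|² − |a − b|² = 4 Re a Re b`, `norm_add_conj_sq_sub_norm_sub_sq`), so that every
statement is an inequality between real rational expressions:

* `poincareExp_triangle` — `e^{ρ(a,c)} ≤ e^{ρ(a,b)} e^{ρ(b,c)}`, from Ptolemy's inequality
  (`EuclideanGeometry.mul_dist_le_mul_dist_add_mul_dist`) for `a, b, c, −conj b` and
  `a, b, −conj c, −conj b`, exactly as Mathlib proves `UpperHalfPlane.dist_triangle`;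
* `poincareExp_le_of_mem_closedBall` — diameter of a disc, through its hyperbolic centre
  `√(Re c² − r²) + i Im c` and the Apollonius description of the disc;
* `phi_le_poincareExp` — `(|a + conj b| + |a − b|)/(2 Re b) ≤ e^{ρ(a,b)}`, i.e. (3.22) in the form
  consumed by (3.25);
* `poincareExp_div_div_le` — `e^{ρ(α/β, γ/δ)} ≤ (1+θ)/(1−θ)` when `|δα − γβ| ≤ θ|δ̄α + γ̄β|`
  ("one checks directly …", end of the proof of Thm 3.6);
* `norm_bounds_of_re_nonpos` — Lemma 3.2 / formula (3.23) in normalized coordinates: the moduli of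
  the disc `{ζ : Re((ζ − 1) conj(ζ b − a)) ≤ 0}` lie between `2 Re a/(|a + conj b| + |a − b|)` and
  `(|a + conj b| + |a − b|)/(2 Re b)`.

Mathlib has the hyperbolic distance on the UPPER half-plane (`UpperHalfPlane.dist`); we do not
transport it (the few inequalities needed are cheaper to prove directly than to move through
`z ↦ I z` and `Real.exp ∘ dist`), and nothing here is specific to cones.

## References
* [Dubois2009] L. Dubois, *Projective metrics and contraction principles for complex cones*,
  J. London Math. Soc. (2) 79 (2009) 719–737 = arXiv:0811.2930, (3.22)–(3.25) and the proof of
  Thm 3.6, pp. 11–13.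
-/

noncomputable section

open scoped ComplexConjugate

namespace Literature.Dynamics.Contraction

section PoincareRHP

/-- `exp` of the Poincaré distance `ρ(a,b)` of the right half-plane `{Re > 0}`, in the squared
form `(|a + conj b| + |a − b|)² / (4 Re a · Re b)`; for `Re a, Re b > 0` this equals
`(|a + conj b| + |a − b|) / (|a + conj b| − |a − b|)`, Dubois' formula (3.22) for `exp ρ(a,b)`.
[cite: Dubois2009, (3.22)] -/
def poincareExp (a b : ℂ) : ℝ :=
  (‖a + conj b‖ + ‖a - b‖) ^ 2 / (4 * a.re * b.re)

/-- The identity `|a + conj b|² − |a − b|² = 4 Re a Re b` behind (3.22). [cite: Dubois2009, (3.22)] -/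
theorem norm_add_conj_sq_sub_norm_sub_sq (a b : ℂ) :
    ‖a + conj b‖ ^ 2 - ‖a - b‖ ^ 2 = 4 * a.re * b.re := by
  simp only [Complex.sq_norm, Complex.normSq_apply, Complex.add_re, Complex.add_im,
    Complex.sub_re, Complex.sub_im, Complex.conj_re, Complex.conj_im]
  ring

/-- In the right half-plane, `|a − b| < |a + conj b|`. [cite: Dubois2009, (3.22)] -/
theorem norm_sub_lt_norm_add_conj {a b : ℂ} (ha : 0 < a.re) (hb : 0 < b.re) :
    ‖a - b‖ < ‖a + conj b‖ := by
  have h := norm_add_conj_sq_sub_norm_sub_sq a b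
  have h4 : 0 < 4 * a.re * b.re := by positivity
  exact (pow_lt_pow_iff_left₀ (norm_nonneg _) (norm_nonneg _) two_ne_zero).1 (by linarith)

/-- `poincareExp` is symmetric. [cite: Dubois2009, (3.22)] -/
theorem poincareExp_comm (a b : ℂ) : poincareExp a b = poincareExp b a := by
  have h1 : ‖b + conj a‖ = ‖a + conj b‖ := by
    have : b + conj a = conj (a + conj b) := by simp [add_comm]
    rw [this, Complex.norm_conj]
  have h2 : ‖b - a‖ = ‖a - b‖ := norm_sub_rev b a
  rw [poincareExp, poincareExp, h1, h2]
  ring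

/-- `poincareExp a b ≥ 0` on the right half-plane. [cite: Dubois2009, (3.22)] -/
theorem poincareExp_nonneg {a b : ℂ} (ha : 0 < a.re) (hb : 0 < b.re) : 0 ≤ poincareExp a b :=
  div_nonneg (sq_nonneg _) (by positivity)

/-- If `|a − b| ≤ t |a + conj b|` with `t < 1` then `exp ρ(a,b) ≤ (1+t)/(1−t)`
(`ρ = 2 artanh` of the pseudo-hyperbolic distance). [cite: Dubois2009, (3.22)] -/
theorem poincareExp_le_of_norm_sub_le {a b : ℂ} {t : ℝ} (ha : 0 < a.re) (hb : 0 < b.re)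
    (ht1 : t < 1) (h : ‖a - b‖ ≤ t * ‖a + conj b‖) :
    poincareExp a b ≤ (1 + t) / (1 - t) := by
  have hkey := norm_add_conj_sq_sub_norm_sub_sq a b
  have hN : 0 ≤ ‖a + conj b‖ := norm_nonneg _
  have hD : 0 ≤ ‖a - b‖ := norm_nonneg _
  rw [poincareExp, div_le_div_iff₀ (by positivity) (by linarith), ← hkey]
  nlinarith [mul_nonneg (add_nonneg hN hD) (sub_nonneg.2 h)]

/-- `(|a + conj b| + |a − b|)/(2 Re b) ≤ exp ρ(a,b)`, i.e. `√(Re a / Re b) e^{ρ/2} ≤ e^{ρ}`, the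
inequality (3.22) `ρ(a,b) ≥ log (Re b / Re a)` in the form used for (3.25).
[cite: Dubois2009, (3.22), (3.25)] -/
theorem phi_le_poincareExp {a b : ℂ} (ha : 0 < a.re) (hb : 0 < b.re) :
    (‖a + conj b‖ + ‖a - b‖) / (2 * b.re) ≤ poincareExp a b := by
  have h2a : 2 * a.re ≤ ‖a + conj b‖ + ‖a - b‖ := by
    have h1 : ((a + conj b) + (a - b)).re = 2 * a.re := by simp; ring
    calc 2 * a.re = ((a + conj b) + (a - b)).re := h1.symm
      _ ≤ ‖(a + conj b) + (a - b)‖ := Complex.re_le_norm _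
      _ ≤ ‖a + conj b‖ + ‖a - b‖ := norm_add_le _ _
  rw [poincareExp, div_le_div_iff₀ (by positivity) (by positivity)]
  have hND : 0 ≤ ‖a + conj b‖ + ‖a - b‖ := by positivity
  nlinarith [mul_nonneg (mul_nonneg hND hb.le) (sub_nonneg.2 h2a)]

/-- **Triangle inequality** for the Poincaré metric of the right half-plane in multiplicative form,
`exp ρ(a,c) ≤ exp ρ(a,b) · exp ρ(b,c)`, from Ptolemy's inequality applied to `a, b, c` and the
reflections `−conj b`, `−conj c` (as in Mathlib's `UpperHalfPlane.dist_triangle`). [folklore] -/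
theorem poincareExp_triangle {a b c : ℂ} (ha : 0 < a.re) (hb : 0 < b.re) (hc : 0 < c.re) :
    poincareExp a c ≤ poincareExp a b * poincareExp b c := by
  have p1 := EuclideanGeometry.mul_dist_le_mul_dist_add_mul_dist a b c (-conj b)
  have p2 := EuclideanGeometry.mul_dist_le_mul_dist_add_mul_dist a b (-conj c) (-conj b)
  simp only [dist_eq_norm, sub_neg_eq_add] at p1 p2
  have e1 : ‖b + conj b‖ = 2 * b.re := by
    rw [Complex.add_conj, Complex.norm_real, Real.norm_of_nonneg (by positivity)]
  have e2 : ‖c + conj b‖ = ‖b + conj c‖ := by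
    have : c + conj b = conj (b + conj c) := by simp [add_comm]
    rw [this, Complex.norm_conj]
  have e3 : ‖-conj c + conj b‖ = ‖b - c‖ := by
    have : -conj c + conj b = conj (b - c) := by simp [sub_eq_add_neg, add_comm]
    rw [this, Complex.norm_conj]
  rw [e1, e2] at p1
  rw [e1, e3] at p2
  have key : 2 * b.re * (‖a + conj c‖ + ‖a - c‖) ≤
      (‖a + conj b‖ + ‖a - b‖) * (‖b + conj c‖ + ‖b - c‖) := by nlinarith [p1, p2]
  have key2 : (2 * b.re * (‖a + conj c‖ + ‖a - c‖)) ^ 2 ≤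
      ((‖a + conj b‖ + ‖a - b‖) * (‖b + conj c‖ + ‖b - c‖)) ^ 2 :=
    pow_le_pow_left₀ (by positivity) key 2
  unfold poincareExp
  rw [div_mul_div_comm, div_le_div_iff₀ (by positivity) (by positivity)]
  calc (‖a + conj c‖ + ‖a - c‖) ^ 2 * (4 * a.re * b.re * (4 * b.re * c.re))
      = (2 * b.re * (‖a + conj c‖ + ‖a - c‖)) ^ 2 * (4 * a.re * c.re) := by ring
    _ ≤ ((‖a + conj b‖ + ‖a - b‖) * (‖b + conj c‖ + ‖b - c‖)) ^ 2 * (4 * a.re * c.re) :=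
        mul_le_mul_of_nonneg_right key2 (by positivity)
    _ = (‖a + conj b‖ + ‖a - b‖) ^ 2 * (‖b + conj c‖ + ‖b - c‖) ^ 2 * (4 * a.re * c.re) := by
        ring

/-- The Poincaré diameter of a Euclidean closed disc `D̄(c, r) ⊂ {Re > 0}` is
`log ((Re c + r)/(Re c − r))` (Dubois 2009, proof of Thm 3.6: "the diameter of a closed disk …
for the Poincaré metric is `ρ(c − r, c + r)`"); here the upper bound, via the hyperbolic centre
`c' = √(Re c² − r²) + i Im c` and the Apollonius description of the disc.
[cite: Dubois2009, proof of Thm 3.6] -/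
theorem poincareExp_le_of_mem_closedBall {c z w : ℂ} {r : ℝ} (hr : 0 ≤ r) (hrc : r < c.re)
    (hz : ‖z - c‖ ≤ r) (hw : ‖w - c‖ ≤ r) :
    poincareExp z w ≤ (c.re + r) / (c.re - r) := by
  set h := c.re with hh
  have hpos : 0 < h := lt_of_le_of_lt hr hrc
  have hhr : 0 < h ^ 2 - r ^ 2 := by nlinarith
  set g := Real.sqrt (h ^ 2 - r ^ 2) with hg
  have hg2 : g ^ 2 = h ^ 2 - r ^ 2 := Real.sq_sqrt hhr.le
  have hgpos : 0 < g := Real.sqrt_pos.2 hhr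
  have hhg : 0 < h + g := by positivity
  set t := r / (h + g) with ht
  have ht1 : t * (h + g) = r := div_mul_cancel₀ _ hhg.ne'
  have ht0 : 0 ≤ t := div_nonneg hr hhg.le
  have htlt : t < 1 := by rw [ht, div_lt_one hhg]; linarith
  have ht2 : t ^ 2 * (h + g) = h - g := by
    have e : t ^ 2 * (h + g) * (h + g) = (h - g) * (h + g) := by
      linear_combination (t * (h + g) + r) * ht1 + hg2
    exact mul_right_cancel₀ hhg.ne' e
  -- the hyperbolic centre of the disc
  set c' : ℂ := ⟨g, c.im⟩ with hc'
  have hc're : c'.re = g := rfl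
  have hc'im : c'.im = c.im := rfl
  -- Apollonius: the disc is `{p : |p - c'| ≤ t |p + conj c'|}`
  have apo : ∀ p : ℂ, ‖p - c‖ ≤ r → ‖p - c'‖ ≤ t * ‖p + conj c'‖ := by
    intro p hp
    have e1 : ‖p - c'‖ ^ 2 = (p.re - g) ^ 2 + (p.im - c.im) ^ 2 := by
      rw [Complex.sq_norm, Complex.normSq_apply]
      simp only [Complex.sub_re, Complex.sub_im, hc're, hc'im]
      ring
    have e2 : ‖p + conj c'‖ ^ 2 = (p.re + g) ^ 2 + (p.im - c.im) ^ 2 := by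
      rw [Complex.sq_norm, Complex.normSq_apply]
      simp only [Complex.add_re, Complex.add_im, Complex.conj_re, Complex.conj_im, hc're, hc'im]
      ring
    have e3 : ‖p - c‖ ^ 2 = (p.re - h) ^ 2 + (p.im - c.im) ^ 2 := by
      rw [Complex.sq_norm, Complex.normSq_apply]
      simp only [Complex.sub_re, Complex.sub_im, hh]
      ring
    have hp2 : ‖p - c‖ ^ 2 ≤ r ^ 2 := pow_le_pow_left₀ (norm_nonneg _) hp 2
    have iden : ‖p - c'‖ ^ 2 - t ^ 2 * ‖p + conj c'‖ ^ 2 =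
        (1 - t ^ 2) * (‖p - c‖ ^ 2 - r ^ 2) := by
      rw [e1, e2, e3]
      linear_combination (-2 * p.re) * ht2 + (1 - t ^ 2) * hg2
    have ht21 : 0 ≤ 1 - t ^ 2 := by nlinarith
    have hle : ‖p - c'‖ ^ 2 ≤ (t * ‖p + conj c'‖) ^ 2 := by
      have : (1 - t ^ 2) * (‖p - c‖ ^ 2 - r ^ 2) ≤ 0 :=
        mul_nonpos_of_nonneg_of_nonpos ht21 (by linarith)
      rw [mul_pow]
      linarith [iden]
    exact (pow_le_pow_iff_left₀ (norm_nonneg _) (by positivity) two_ne_zero).1 hle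
  have re_pos : ∀ p : ℂ, ‖p - c‖ ≤ r → 0 < p.re := by
    intro p hp
    have h1 : |(p - c).re| ≤ ‖p - c‖ := Complex.abs_re_le_norm _
    rw [Complex.sub_re, abs_le] at h1
    linarith [h1.1]
  have hzre := re_pos z hz
  have hwre := re_pos w hw
  have hc'pos : 0 < c'.re := hgpos
  have h1 : poincareExp z c' ≤ (1 + t) / (1 - t) :=
    poincareExp_le_of_norm_sub_le hzre hc'pos htlt (apo z hz)
  have h2 : poincareExp c' w ≤ (1 + t) / (1 - t) := by
    rw [poincareExp_comm]
    exact poincareExp_le_of_norm_sub_le hwre hc'pos htlt (apo w hw)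
  have hT0 : 0 ≤ (1 + t) / (1 - t) := div_nonneg (by linarith) (by linarith)
  have hT : (1 + t) / (1 - t) * ((1 + t) / (1 - t)) = (h + r) / (h - r) := by
    rw [div_mul_div_comm, div_eq_div_iff (by nlinarith) (by linarith)]
    linear_combination (2 * (1 + t ^ 2)) * ht1 + (-2 * t) * ht2
  calc poincareExp z w ≤ poincareExp z c' * poincareExp c' w := poincareExp_triangle hzre hc'pos hwre
    _ ≤ (1 + t) / (1 - t) * ((1 + t) / (1 - t)) :=
        mul_le_mul h1 h2 (poincareExp_nonneg hc'pos hwre) hT0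
    _ = (h + r) / (h - r) := hT

/-- `exp ρ(α/β, γ/δ) ≤ (1+θ)/(1−θ)` as soon as `|δα − γβ| ≤ θ |conj δ · α + conj γ · β|` — the
"one checks directly" step at the end of the proof of Thm 3.6 (row pairs) and the middle link
`ρ(a_lq/a_kq, a_lr/a_kr)` of its chain of discs (column pairs). [cite: Dubois2009, proof of Thm 3.6] -/
theorem poincareExp_div_div_le {α β γ δ : ℂ} {θ : ℝ} (hθ1 : θ < 1) (hβ : β ≠ 0) (hδ : δ ≠ 0)
    (hαβ : 0 < (α / β).re) (hγδ : 0 < (γ / δ).re)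
    (h : ‖δ * α - γ * β‖ ≤ θ * ‖conj δ * α + conj γ * β‖) :
    poincareExp (α / β) (γ / δ) ≤ (1 + θ) / (1 - θ) := by
  apply poincareExp_le_of_norm_sub_le hαβ hγδ hθ1
  have hδ' : conj δ ≠ 0 := (map_ne_zero _).2 hδ
  have e1 : α / β - γ / δ = (δ * α - γ * β) / (β * δ) := by
    field_simp
  have e2 : α / β + conj (γ / δ) = (conj δ * α + conj γ * β) / (β * conj δ) := by
    rw [map_div₀]
    field_simp
  have hpos : 0 < ‖β‖ * ‖δ‖ := by positivity
  rw [e1, e2, norm_div, norm_div, norm_mul, norm_mul, Complex.norm_conj]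
  calc ‖δ * α - γ * β‖ / (‖β‖ * ‖δ‖) ≤ (θ * ‖conj δ * α + conj γ * β‖) / (‖β‖ * ‖δ‖) :=
        div_le_div_of_nonneg_right h hpos.le
    _ = θ * (‖conj δ * α + conj γ * β‖ / (‖β‖ * ‖δ‖)) := mul_div_assoc _ _ _

end PoincareRHP

section NormalizedDisc

/-- Lemma 3.2 in normalized coordinates (`x_k = y_k = 1`, `a = y_l`, `b = x_l`): the condition
`Re((ζ − 1) conj(ζ b − a)) ≤ 0` puts `ζ` in the disc of centre `(a + conj b)/(2 Re b)` and radius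
`|a − b|/(2 Re b)`, whence `|ζ| ≤ (|a + conj b| + |a − b|)/(2 Re b)` and
`|ζ| ≥ (|a + conj b| − |a − b|)/(2 Re b) = 2 Re a/(|a + conj b| + |a − b|)` (formula (3.23)).
[cite: Dubois2009, Lemma 3.2, (3.23)] -/
theorem norm_bounds_of_re_nonpos {a b ζ : ℂ} (hb : 0 < b.re)
    (h : ((ζ - 1) * conj (ζ * b - a)).re ≤ 0) :
    ‖ζ‖ * (2 * b.re) ≤ ‖a + conj b‖ + ‖a - b‖ ∧
      2 * a.re ≤ ‖ζ‖ * (‖a + conj b‖ + ‖a - b‖) := by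
  have iden : ‖((2 * b.re : ℝ) : ℂ) * ζ - (a + conj b)‖ ^ 2 - ‖a - b‖ ^ 2 =
      4 * b.re * ((ζ - 1) * conj (ζ * b - a)).re := by
    simp only [Complex.sq_norm, Complex.normSq_apply, Complex.sub_re, Complex.sub_im,
      Complex.add_re, Complex.add_im, Complex.mul_re, Complex.mul_im, Complex.conj_re,
      Complex.conj_im, Complex.ofReal_re, Complex.ofReal_im, Complex.one_re, Complex.one_im]
    ring
  have hle : ‖((2 * b.re : ℝ) : ℂ) * ζ - (a + conj b)‖ ≤ ‖a - b‖ := by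
    apply (pow_le_pow_iff_left₀ (norm_nonneg _) (norm_nonneg _) two_ne_zero).1
    nlinarith [iden, h, hb]
  have hn : ‖((2 * b.re : ℝ) : ℂ) * ζ‖ = ‖ζ‖ * (2 * b.re) := by
    rw [norm_mul, Complex.norm_real, Real.norm_of_nonneg (by positivity)]
    ring
  have hkey := norm_add_conj_sq_sub_norm_sub_sq a b
  have hN : 0 ≤ ‖a + conj b‖ := norm_nonneg _
  have hD : 0 ≤ ‖a - b‖ := norm_nonneg _
  have habs := abs_norm_sub_norm_le (((2 * b.re : ℝ) : ℂ) * ζ) (a + conj b)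
  rw [abs_le, hn] at habs
  have up : ‖ζ‖ * (2 * b.re) ≤ ‖a + conj b‖ + ‖a - b‖ := by linarith [habs.2]
  refine ⟨up, ?_⟩
  -- lower bound: `|m| − |2bζ − m| ≤ |2bζ|`, then multiply by `|m| + |a-b|`
  have low : ‖a + conj b‖ - ‖a - b‖ ≤ ‖ζ‖ * (2 * b.re) := by linarith [habs.1]
  have hprod : (‖a + conj b‖ - ‖a - b‖) * (‖a + conj b‖ + ‖a - b‖) ≤
      ‖ζ‖ * (2 * b.re) * (‖a + conj b‖ + ‖a - b‖) :=
    mul_le_mul_of_nonneg_right low (by positivity)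
  have e : (‖a + conj b‖ - ‖a - b‖) * (‖a + conj b‖ + ‖a - b‖) = 4 * a.re * b.re := by
    rw [← hkey]; ring
  rw [e] at hprod
  nlinarith [hprod, hb, norm_nonneg ζ]

end NormalizedDisc

end Literature.Dynamics.Contraction

end
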